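import Literature.AlgebraicGeometry.Frobenioids.CategoriesFactorization
import Literature.AlgebraicGeometry.Frobenioids.ArchimedeanBaseComparison
import HarnessLib

/-!
# A three-object base category over `D₀` that is NOT totally epimorphic (input of the kernel
# counterexample to the universal closure of [FrdII] Prop. 3.5 (ii) as typed, `ArchFrd.Prop35ii_C` /
# `ArchFrd.Prop35ii_A`, FACT-LIST rows F-0862 / F-0861)

Mochizuki, *The geometry of Frobenioids II: poly-Frobenioids*, Kyushu J. Math. **62** (2008)
401–460, §3, Example 3.3 (i) p. 28 ("if `D` is any connected, totally epimorphic category, and `D → D₀`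
is a functor …") and Proposition 3.5 (ii) p. 34 [cite: MochizukiFrdII2008, Prop 3.5 (ii) p.34]; [FrdI] §0
pp. 17–18 (irreducible arrows, anchors) [cite: MochizukiFrdI2008, §0 p.18].

This file builds the TOY BASE CATEGORY used by `ArchimedeanProp35iiCounterexample.lean` (seat
abc-iut-f-014, block F of the abc-iut cell): the full subcategory of the category of finite `ℤ/2`-sets
on the three objects `c` (the free orbit `ℤ/2`, automorphisms `{1, σ}`), `p` (the point) and `e` (two
points with the trivial action, `pt ⊔ pt`), with ALL equivariant maps between them: `Aut(c) = {1, σ}`,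
one map `c → p`, the two constant maps `c → e`, the two sections `p → e`, the retraction `e → p`, the
four self-maps of `e`, and no maps into `c` from `p` or `e`. PROVED (finite case analysis): the laws of
a category; `T` is connected (`T.isGraphConnected`) but NOT totally epimorphic (`p → e` is a split
monomorphism which is not an epimorphism, `T.not_isTotallyEpimorphic`); every arrow of `T` is an
isomorphism or factors through two non-isomorphisms (`T.iso_or_reducible`), so NO arrow of `T` is
irreducible (`T.not_isIrreducibleHom`) and every object is an anchor. The categorical quotients of `T`
and its RC-structure over `D₀` (constant functor at `Spec ℂ`; `T` is of RC-iso-subanchor type) are in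
the sequel `ArchimedeanProp35iiToyBaseRC.lean`.

Everything is finite; no `Prop`-valued fact is introduced. The point of the construction is recorded
in `ArchimedeanProp35iiCounterexample.lean`: [FrdII] Prop. 3.5 (ii) as typed, WITHOUT the printed
standing hypothesis "`D` totally epimorphic" of Example 3.3 (i), fails over this base. Nothing here
bears on [IUTchIII] Cor. 3.12; a refuted universal closure is a statement about OUR typing, not about
the paper.
-/

namespace Literature.AlgebraicGeometry.Frobenioids

open CategoryTheory

namespace ArchFrd

namespace P35iiToy

/-! ### The toy base category `T` -/

/-- The objects of the toy base: `c` (the free `ℤ/2`-orbit), `p` (the point), `e` (two fixed points).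
[cite: MochizukiFrdII2008, Prop 3.5 (ii) p.34] -/
inductive T : Type
  /-- the free `ℤ/2`-orbit -/
  | c
  /-- the point -/
  | p
  /-- two points with trivial action, `pt ⊔ pt` -/
  | e
  deriving DecidableEq, Inhabited

namespace T

/-- Morphisms of `T` = the `ℤ/2`-equivariant maps: `Aut(c) = {x ↦ x, x ↦ ¬x}` (a Boolean `s`, the map
`x ↦ s xor x`), the unique map `c → p`, the constant maps `c → e` (a Boolean value), the identity of `p`,
the two points `p → e`, the unique map `e → p`, and the four self-maps of `e` (a function `Bool → Bool`);
no maps `p → c`, `e → c`. [cite: MochizukiFrdII2008, Prop 3.5 (ii) p.34] -/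
inductive Hom : T → T → Type
  /-- the automorphism `x ↦ s xor x` of `c` (`s = true` is the swap `σ`) -/
  | auto (s : Bool) : Hom c c
  /-- the quotient map `c → p` -/
  | cp : Hom c p
  /-- the constant map `c → e` with value `i` -/
  | ce (i : Bool) : Hom c e
  /-- the identity of `p` -/
  | pp : Hom p p
  /-- the point `i` of `e`, as a map `p → e` -/
  | pe (i : Bool) : Hom p e
  /-- the unique map `e → p` -/
  | ep : Hom e p
  /-- the self-map `g` of `e = {false, true}` -/
  | ee (g : Bool → Bool) : Hom e e

/-- Composition (diagrammatic order) = composition of the underlying maps of finite sets.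
[cite: MochizukiFrdII2008, Prop 3.5 (ii) p.34] -/
def Hom.comp : {X Y Z : T} → Hom X Y → Hom Y Z → Hom X Z
  | _, _, _, .auto s, .auto t => .auto (xor s t)
  | _, _, _, .auto _, .cp => .cp
  | _, _, _, .auto _, .ce i => .ce i
  | _, _, _, .cp, .pp => .cp
  | _, _, _, .cp, .pe i => .ce i
  | _, _, _, .ce _, .ep => .cp
  | _, _, _, .ce i, .ee g => .ce (g i)
  | _, _, _, .pp, .pp => .pp
  | _, _, _, .pp, .pe i => .pe i
  | _, _, _, .pe _, .ep => .pp
  | _, _, _, .pe i, .ee g => .pe (g i)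
  | _, _, _, .ep, .pp => .ep
  | _, _, _, .ep, .pe i => .ee (fun _ => i)
  | _, _, _, .ee _, .ep => .ep
  | _, _, _, .ee g, .ee g' => .ee (g' ∘ g)

/-- Identities. [cite: MochizukiFrdII2008, Prop 3.5 (ii) p.34] -/
def Hom.id : (X : T) → Hom X X
  | .c => .auto false
  | .p => .pp
  | .e => .ee _root_.id

/-- `T` is a category (laws by cases on the finitely many shapes of arrows).
[cite: MochizukiFrdII2008, Prop 3.5 (ii) p.34] -/
instance instCategory : Category T where
  Hom := Hom
  id := Hom.id
  comp := Hom.comp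
  id_comp φ := by
    cases φ <;> first | rfl | simp only [Hom.id, Hom.comp, Bool.false_xor]
  comp_id φ := by
    cases φ <;> first | rfl | simp only [Hom.id, Hom.comp, Bool.xor_false]
  assoc φ ψ χ := by
    cases φ <;> cases ψ <;> cases χ <;> first | rfl | simp only [Hom.comp, Bool.xor_assoc]

/-! ### Names for the arrows -/

/-- The automorphism `x ↦ s xor x` of `c`, as an arrow of `T`. [cite: MochizukiFrdII2008, Prop 3.5 (ii) p.34] -/
def au (s : Bool) : c ⟶ c := Hom.auto s

/-- The swap `σ` of the free orbit `c`. [cite: MochizukiFrdII2008, Prop 3.5 (ii) p.34] -/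
def sw : c ⟶ c := Hom.auto true

/-- The quotient map `c → p`. [cite: MochizukiFrdII2008, Prop 3.5 (ii) p.34] -/
def quot : c ⟶ p := Hom.cp

/-- The constant map `c → e` with value `i`. [cite: MochizukiFrdII2008, Prop 3.5 (ii) p.34] -/
def cst (i : Bool) : c ⟶ e := Hom.ce i

/-- The section `p → e` picking the point `i`. [cite: MochizukiFrdII2008, Prop 3.5 (ii) p.34] -/
def sec (i : Bool) : p ⟶ e := Hom.pe i

/-- The retraction `e → p`. [cite: MochizukiFrdII2008, Prop 3.5 (ii) p.34] -/
def ret : e ⟶ p := Hom.ep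

/-- The self-map of `e` with underlying function `g`. [cite: MochizukiFrdII2008, Prop 3.5 (ii) p.34] -/
def emap (g : Bool → Bool) : e ⟶ e := Hom.ee g

/-! ### Shapes of arrows -/

/-- Every arrow `c → c` is some `au s`. [cite: MochizukiFrdII2008, Prop 3.5 (ii) p.34] -/
theorem hom_cc_eq (φ : c ⟶ c) : ∃ s : Bool, φ = au s := by
  cases φ with
  | auto s => exact ⟨s, rfl⟩

/-- Every arrow `c → e` is some `cst i`. [cite: MochizukiFrdII2008, Prop 3.5 (ii) p.34] -/
theorem hom_ce_eq (φ : c ⟶ e) : ∃ i : Bool, φ = cst i := by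
  cases φ with
  | ce i => exact ⟨i, rfl⟩

/-- Every arrow `p → e` is some `sec i`. [cite: MochizukiFrdII2008, Prop 3.5 (ii) p.34] -/
theorem hom_pe_eq (φ : p ⟶ e) : ∃ i : Bool, φ = sec i := by
  cases φ with
  | pe i => exact ⟨i, rfl⟩

/-- Every arrow `e → e` is some `emap g`. [cite: MochizukiFrdII2008, Prop 3.5 (ii) p.34] -/
theorem hom_ee_eq (φ : e ⟶ e) : ∃ g : Bool → Bool, φ = emap g := by
  cases φ with
  | ee g => exact ⟨g, rfl⟩

/-- `Hom(c, p)` is a singleton. [cite: MochizukiFrdII2008, Prop 3.5 (ii) p.34] -/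
instance subsingleton_hom_cp : Subsingleton (c ⟶ p) :=
  ⟨fun φ ψ => by cases φ; cases ψ; rfl⟩

/-- `Hom(p, p)` is a singleton. [cite: MochizukiFrdII2008, Prop 3.5 (ii) p.34] -/
instance subsingleton_hom_pp : Subsingleton (p ⟶ p) :=
  ⟨fun φ ψ => by cases φ; cases ψ; rfl⟩

/-- `Hom(e, p)` is a singleton. [cite: MochizukiFrdII2008, Prop 3.5 (ii) p.34] -/
instance subsingleton_hom_ep : Subsingleton (e ⟶ p) :=
  ⟨fun φ ψ => by cases φ; cases ψ; rfl⟩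

/-- `Hom(p, c)` is empty (no fixed point in the free orbit). [cite: MochizukiFrdII2008, Prop 3.5 (ii) p.34] -/
instance isEmpty_hom_pc : IsEmpty (p ⟶ c) :=
  ⟨fun φ => by cases φ⟩

/-- `Hom(e, c)` is empty. [cite: MochizukiFrdII2008, Prop 3.5 (ii) p.34] -/
instance isEmpty_hom_ec : IsEmpty (e ⟶ c) :=
  ⟨fun φ => by cases φ⟩

/-! ### Composition table -/

/-- `au s ∘ au t = au (s xor t)`. [cite: MochizukiFrdII2008, Prop 3.5 (ii) p.34] -/
@[simp] theorem au_comp_au (s t : Bool) : au s ≫ au t = au (xor s t) := rfl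

/-- The identity of `c` is `au false`. [cite: MochizukiFrdII2008, Prop 3.5 (ii) p.34] -/
theorem id_c : (𝟙 c : c ⟶ c) = au false := rfl

/-- `σ = au true`. [cite: MochizukiFrdII2008, Prop 3.5 (ii) p.34] -/
theorem sw_eq : sw = au true := rfl

/-- `σ ∘ σ = 1`. [cite: MochizukiFrdII2008, Prop 3.5 (ii) p.34] -/
@[simp] theorem sw_comp_sw : sw ≫ sw = 𝟙 c := rfl

/-- `σ ≠ 1`. [cite: MochizukiFrdII2008, Prop 3.5 (ii) p.34] -/
theorem sw_ne_id : sw ≠ 𝟙 c := by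
  intro h
  have h' : Hom.auto true = Hom.auto false := h
  cases h'

/-- `c → p` is `Aut(c)`-invariant. [cite: MochizukiFrdII2008, Prop 3.5 (ii) p.34] -/
@[simp] theorem au_comp_quot (s : Bool) : au s ≫ quot = quot := rfl

/-- `σ` fixes `c → p`. [cite: MochizukiFrdII2008, Prop 3.5 (ii) p.34] -/
@[simp] theorem sw_comp_quot : sw ≫ quot = quot := rfl

/-- The constant maps `c → e` are `Aut(c)`-invariant. [cite: MochizukiFrdII2008, Prop 3.5 (ii) p.34] -/
@[simp] theorem au_comp_cst (s i : Bool) : au s ≫ cst i = cst i := rfl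

/-- `σ` fixes the constant maps `c → e`. [cite: MochizukiFrdII2008, Prop 3.5 (ii) p.34] -/
@[simp] theorem sw_comp_cst (i : Bool) : sw ≫ cst i = cst i := rfl

/-- `(c → p → e) = ` the constant map. [cite: MochizukiFrdII2008, Prop 3.5 (ii) p.34] -/
@[simp] theorem quot_comp_sec (i : Bool) : quot ≫ sec i = cst i := rfl

/-- `(c → e → p) = (c → p)`. [cite: MochizukiFrdII2008, Prop 3.5 (ii) p.34] -/
@[simp] theorem cst_comp_ret (i : Bool) : cst i ≫ ret = quot := rfl

/-- `p → e → p` is the identity: `p` is a RETRACT of `e`. [cite: MochizukiFrdII2008, Prop 3.5 (ii) p.34] -/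
@[simp] theorem sec_comp_ret (i : Bool) : sec i ≫ ret = 𝟙 p := rfl

/-- `e → p → e` is the constant self-map. [cite: MochizukiFrdII2008, Prop 3.5 (ii) p.34] -/
@[simp] theorem ret_comp_sec (i : Bool) : ret ≫ sec i = emap (fun _ => i) := rfl

/-- Post-composing a constant map with a self-map of `e`. [cite: MochizukiFrdII2008, Prop 3.5 (ii) p.34] -/
@[simp] theorem cst_comp_emap (i : Bool) (g : Bool → Bool) : cst i ≫ emap g = cst (g i) := rfl

/-- Post-composing a section with a self-map of `e`. [cite: MochizukiFrdII2008, Prop 3.5 (ii) p.34] -/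
@[simp] theorem sec_comp_emap (i : Bool) (g : Bool → Bool) : sec i ≫ emap g = sec (g i) := rfl

/-- Composition of self-maps of `e`. [cite: MochizukiFrdII2008, Prop 3.5 (ii) p.34] -/
@[simp] theorem emap_comp_emap (g g' : Bool → Bool) : emap g ≫ emap g' = emap (g' ∘ g) := rfl

/-- A self-map of `e` followed by `e → p`. [cite: MochizukiFrdII2008, Prop 3.5 (ii) p.34] -/
@[simp] theorem emap_comp_ret (g : Bool → Bool) : emap g ≫ ret = ret := rfl

/-- The identity of `e` is `emap id`. [cite: MochizukiFrdII2008, Prop 3.5 (ii) p.34] -/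
theorem id_e : (𝟙 e : e ⟶ e) = emap _root_.id := rfl

/-- The identity of `p` is the constructor `pp`. [cite: MochizukiFrdII2008, Prop 3.5 (ii) p.34] -/
theorem id_p : (𝟙 p : p ⟶ p) = Hom.pp := rfl

/-- `emap` is injective. [cite: MochizukiFrdII2008, Prop 3.5 (ii) p.34] -/
theorem emap_injective {g g' : Bool → Bool} (h : emap g = emap g') : g = g' :=
  Hom.ee.inj h

/-- `cst` is injective. [cite: MochizukiFrdII2008, Prop 3.5 (ii) p.34] -/
theorem cst_injective {i j : Bool} (h : cst i = cst j) : i = j :=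
  Hom.ce.inj h

/-- `sec` is injective. [cite: MochizukiFrdII2008, Prop 3.5 (ii) p.34] -/
theorem sec_injective {i j : Bool} (h : sec i = sec j) : i = j :=
  Hom.pe.inj h

/-- A constant function on `Bool` is not the identity (so `e → p → e` is not the identity of `e`).
[cite: MochizukiFrdII2008, Prop 3.5 (ii) p.34] -/
theorem const_ne_id (i : Bool) : (fun _ : Bool => i) ≠ _root_.id := by
  intro h
  have h' := congrFun h (!i)
  revert h'
  cases i <;> decide

/-! ### Isomorphisms and non-isomorphisms -/

/-- The automorphism `au s` as an isomorphism (its own inverse). [cite: MochizukiFrdII2008, Prop 3.5 (ii) p.34] -/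
def auIso (s : Bool) : c ≅ c where
  hom := au s
  inv := au s
  hom_inv_id := by rw [au_comp_au, Bool.xor_self, id_c]
  inv_hom_id := by rw [au_comp_au, Bool.xor_self, id_c]

/-- The swap `σ` as an element of `Aut(c)`. [cite: MochizukiFrdII2008, Prop 3.5 (ii) p.34] -/
def swIso : c ≅ c := auIso true

/-- `swIso.hom = σ`. [cite: MochizukiFrdII2008, Prop 3.5 (ii) p.34] -/
@[simp] theorem swIso_hom : swIso.hom = sw := rfl

/-- Every arrow `c → c` is an isomorphism. [cite: MochizukiFrdII2008, Prop 3.5 (ii) p.34] -/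
theorem isIso_hom_cc (φ : c ⟶ c) : IsIso φ := by
  obtain ⟨s, rfl⟩ := hom_cc_eq φ
  exact (auIso s).isIso_hom

/-- `c → p` is not an isomorphism (`Hom(p, c) = ∅`). [cite: MochizukiFrdII2008, Prop 3.5 (ii) p.34] -/
theorem not_isIso_quot : ¬ IsIso quot := fun _ => isEmpty_hom_pc.false (inv quot)

/-- `c → e` is not an isomorphism (`Hom(e, c) = ∅`). [cite: MochizukiFrdII2008, Prop 3.5 (ii) p.34] -/
theorem not_isIso_cst (i : Bool) : ¬ IsIso (cst i) := fun _ => isEmpty_hom_ec.false (inv (cst i))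

/-- The section `p → e` is not an isomorphism (`e → p → e` is constant).
[cite: MochizukiFrdII2008, Prop 3.5 (ii) p.34] -/
theorem not_isIso_sec (i : Bool) : ¬ IsIso (sec i) := by
  intro h
  have h1 : inv (sec i) ≫ sec i = 𝟙 e := IsIso.inv_hom_id (sec i)
  rw [Subsingleton.elim (inv (sec i)) ret, ret_comp_sec, id_e] at h1
  exact const_ne_id i (emap_injective h1)

/-- The retraction `e → p` is not an isomorphism. [cite: MochizukiFrdII2008, Prop 3.5 (ii) p.34] -/
theorem not_isIso_ret : ¬ IsIso ret := by
  intro h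
  obtain ⟨j, hj⟩ := hom_pe_eq (inv ret)
  have h1 : ret ≫ inv ret = 𝟙 e := IsIso.hom_inv_id ret
  rw [hj, ret_comp_sec, id_e] at h1
  exact const_ne_id j (emap_injective h1)

/-- A constant self-map of `e` is not an isomorphism. [cite: MochizukiFrdII2008, Prop 3.5 (ii) p.34] -/
theorem not_isIso_emap_const (i : Bool) : ¬ IsIso (emap (fun _ => i)) := by
  intro h
  obtain ⟨g', hg'⟩ := hom_ee_eq (inv (emap (fun _ => i)))
  have h1 : emap (fun _ => i) ≫ inv (emap (fun _ => i)) = 𝟙 e := IsIso.hom_inv_id _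
  rw [hg', emap_comp_emap, id_e] at h1
  exact const_ne_id (g' i) (emap_injective h1)

/-- On `Bool`, a left inverse is a right inverse. [folklore] -/
private theorem bool_rightInverse :
    ∀ g g' : Bool → Bool, (∀ x, g' (g x) = x) → ∀ y, g (g' y) = y := by
  decide

/-- A self-map of `e` with a left inverse is an isomorphism. [cite: MochizukiFrdII2008, Prop 3.5 (ii) p.34] -/
theorem isIso_emap_of_comp_eq_id {g g' : Bool → Bool} (h : emap g ≫ emap g' = 𝟙 e) : IsIso (emap g) := by
  rw [emap_comp_emap, id_e] at h
  have h1 : ∀ x, g' (g x) = x := fun x => congrFun (emap_injective h) x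
  have h2 : ∀ y, g (g' y) = y := bool_rightInverse g g' h1
  refine ⟨⟨emap g', ?_, ?_⟩⟩
  · rw [emap_comp_emap, id_e]
    exact congrArg emap (funext h1)
  · rw [emap_comp_emap, id_e]
    exact congrArg emap (funext h2)

/-- **Every arrow of `T` is an isomorphism or a composite of two NON-isomorphisms** — so no arrow of
`T` is irreducible in the sense of [FrdI] §0 and every object is an anchor. [cite: MochizukiFrdI2008, §0 p.18] -/
theorem iso_or_reducible {X Y : T} (φ : X ⟶ Y) :
    IsIso φ ∨ ∃ (Z : T) (β : X ⟶ Z) (α : Z ⟶ Y), β ≫ α = φ ∧ ¬ IsIso β ∧ ¬ IsIso α := by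
  cases φ with
  | auto s => exact Or.inl (isIso_hom_cc _)
  | cp => exact Or.inr ⟨e, cst false, ret, rfl, not_isIso_cst false, not_isIso_ret⟩
  | ce i => exact Or.inr ⟨p, quot, sec i, rfl, not_isIso_quot, not_isIso_sec i⟩
  | pp => exact Or.inl (IsIso.id p)
  | pe i => exact Or.inr ⟨e, sec i, emap (fun _ => i), rfl, not_isIso_sec i, not_isIso_emap_const i⟩
  | ep => exact Or.inr ⟨e, emap (fun _ => false), ret, rfl, not_isIso_emap_const false, not_isIso_ret⟩
  | ee g =>
    by_cases hg : g false = g true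
    · -- `g` is constant
      have hc : g = fun _ => g false := by
        funext x
        cases x
        · rfl
        · exact hg.symm
      refine Or.inr ⟨p, ret, sec (g false), ?_, not_isIso_ret, not_isIso_sec _⟩
      rw [ret_comp_sec]
      exact congrArg emap hc.symm
    · -- `g` is a bijection, `g ∘ g = id` or `g = id`; in both cases `g ∘ g ∘ g ∘ g = id`
      refine Or.inl (isIso_emap_of_comp_eq_id (g' := g ∘ g ∘ g) ?_)
      rw [emap_comp_emap, id_e]
      refine congrArg emap (funext fun x => ?_)
      revert hg
      cases hf : g false <;> cases ht : g true <;> cases x <;> simp [hf, ht]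

/-- No arrow of `T` is irreducible. [cite: MochizukiFrdI2008, §0 p.18] -/
theorem not_isIrreducibleHom {X Y : T} (φ : X ⟶ Y) : ¬ IsIrreducibleHom φ := by
  intro h
  rcases iso_or_reducible φ with hφ | ⟨Z, β, α, hfac, hβ, hα⟩
  · exact h.1 hφ
  · rcases h.2 β α hfac with hα' | hβ'
    · exact hα hα'
    · exact hβ hβ'

/-- `T` is connected (every object maps to `p`). [cite: MochizukiFrdII2008, Ex 3.3 (i) p.28] -/
theorem isGraphConnected : IsGraphConnected T := by
  refine ⟨⟨p⟩, fun X Y => ?_⟩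
  have toP : ∀ Z : T, Nonempty (Z ⟶ p) := fun Z => by
    cases Z
    · exact ⟨quot⟩
    · exact ⟨𝟙 p⟩
    · exact ⟨ret⟩
  exact (Zigzag.of_hom (toP X).some).trans (Zigzag.of_inv (toP Y).some)

/-- **`T` is NOT totally epimorphic**: the section `p → e` is not an epimorphism (the identity and a
constant self-map of `e` agree on it). [cite: MochizukiFrdII2008, Ex 3.3 (i) p.28] -/
theorem not_isTotallyEpimorphic : ¬ IsTotallyEpimorphic T := by
  intro h
  haveI := h.epi (sec false)
  have h1 : sec false ≫ emap _root_.id = sec false ≫ emap (fun _ => false) := rfl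
  exact const_ne_id false (emap_injective ((cancel_epi (sec false)).mp h1)).symm

/-- The section `p → e` is a split monomorphism that is not an isomorphism: `p` is a proper retract
of `e`. [cite: MochizukiFrdII2008, Ex 3.3 (i) p.28] -/
theorem isSplitMono_sec (i : Bool) : IsSplitMono (sec i) :=
  IsSplitMono.mk' ⟨ret, sec_comp_ret i⟩

end T

end P35iiToy

end ArchFrd

end Literature.AlgebraicGeometry.Frobenioids
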